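import Summits.QuantumFields.BalabanUV.T4Continuum.Support.GradedWellBackground
import Summits.QuantumFields.BalabanUV.T4Continuum.Support.OutputRateTowerInstance

/-!
# T⁴ programme — THE JUNCTION NE5 ⇐ NE2(Δ1 × tier B): row NE5's W1 carrier law `TowerLaw` for the background-perturbed GRADED-WELL towers
# (`towerLaw_GW_of_tierB`, `towerLaw_GW_balaban`) — the graded-well twin of `OutputRateTowerBalaban.towerLaw_perturbed_king_kron` / `towerLaw_balaban_final_of_small`

Cell `pub-balaban-gaps` (YM blitz, track G2, seat ne2 = spine estimate NE2; census `run/shared/lean/pub/pub-balaban-gaps/ne/NE2.md`).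
Row NE5's W1 socket (`OutputRateTowerSocket.TowerLaw`, instance `OutputRateTowerInstance.towerLaw_perturbed`) asks a `FreeTowerLaws` (U = 1) and, per
family index, row NE2's `PerturbationLaws`.  For the single-region torus operator this is leaf-08's `OutputRateTowerBalaban` (B7 × NE5 junction).  THIS FILE
is the same junction for the GRADED WELL (sub-row Δ1, any layer map `layer ≤ m`): `hfree := freeTowerLaws_kron o (GradedWellTowerEnd.freeTowerLaws_GW …)`
(NO binder) and `hpert j := GradedWellBackground.perturbationLaws_GW_of_tierB … (hP j)` (row NE2's `TierBLaws` transferred to the graded well):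
 * **`towerLaw_GW_of_tierB (hP : ∀ j, TierBLaws L M a ha (P j) κ C₂) (ht : ‖t‖·κ(1 + ε_GW) < 1)`** — ONE constant, ONE rate `L⁻¹` for the whole family;
 * **`towerLaw_GW_balaban`** — the family `P j := balabanPert (liftR (Rg j)) (gaugeSlot (Rg j) …) b′` of Bałaban's typed tier-B operators under ROOT B's
   per-member binders (`hreg j`, `hNE3 j` = node NE3 BY NAME, common `hκ`, `hsmall`) — `hP j := NE2BalabanFinal.perturbationLaws_balaban_final`.

HONEST FRAMING (T4-DAG p. 1).  Junction bookkeeping (two applications of landed theorems); MODEL LEVEL (graded well with `m` fixed on unit blocks, finite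
torus, operator norm; `Rg` DATA, dictionary B0 asserted nowhere; NE3 displayed); NE5 NOT proved, NE2 (U1a) NOT proved, NE3 NOT proved; spine PROVED 0/9
unchanged; NOT [B9] as printed; NOT continuum YM, NOT infinite volume / mass gap / Clay.  HONEST DEPENDENCY: continuum YM on T⁴ ⇐ BetaPertH ∧ nine spine
estimates (0/9 proved); BetaPertH ⇐ (D1) ∧ (D4) ∧ CAP+tail; G-an2-4 gates asym, D1 and NE2/3/4.  No `sorry`, no `def`.
-/

noncomputable section

open scoped BigOperators ComplexConjugate Matrix Matrix.Norms.L2Operator Kronecker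

namespace Summit.QuantumFields.BalabanUV.T4Continuum.OutputRateTowerGradedWell

open Literature.MathematicalPhysics.QuantumFieldTheory.Balaban1983to89.B5Prop11Plancherel (Tor fine Cst Cst_nonneg)
open Literature.MathematicalPhysics.QuantumFieldTheory.Balaban1983to89.B5G183RateUnitTower (lev lev_neZero)
open Literature.MathematicalPhysics.QuantumFieldTheory.Balaban1983to89.T4EtaRateMin (LocalRate)
open Summit.QuantumFields.BalabanUV.T4Continuum
open Summit.QuantumFields.BalabanUV.T4Continuum.CovariantAveragingTower (TowerLimitRate)
open Summit.QuantumFields.BalabanUV.T4Continuum.BackgroundResolventTower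
open Summit.QuantumFields.BalabanUV.T4Continuum.BalabanAveragedTowerUnit (idx Qlev)
open Summit.QuantumFields.BalabanUV.T4Continuum.KingPairingPlantedLaw (JpcT calDalev CJ)
open Summit.QuantumFields.BalabanUV.T4Continuum.KroneckerLift (freeTowerLaws_kron)
open Summit.QuantumFields.BalabanUV.T4Continuum.NE2.Targets (TierBLaws)
open Summit.QuantumFields.BalabanUV.T4Continuum.GramPerturbationLaw (C2gram)
open Summit.QuantumFields.BalabanUV.T4Continuum.NE2FromNE3 (bgReadings)
open Summit.QuantumFields.BalabanUV.T4Continuum.RegularBackgroundTower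
open Summit.QuantumFields.BalabanUV.T4Continuum.CovariantAveragingSummand (kappaQ)
open Summit.QuantumFields.BalabanUV.T4Continuum.GaugeTermPerturbationLaw (deltaK)
open Summit.QuantumFields.BalabanUV.T4Continuum.GaugeTermScalarData (QuT Q1)
open Summit.QuantumFields.BalabanUV.T4Continuum.GaugeTermInstanceGeom (gS)
open Summit.QuantumFields.BalabanUV.T4Continuum.ScalarAveragedCompression (sigma0)
open Summit.QuantumFields.BalabanUV.T4Continuum.ScalarCovariantLaplacian (kappaS)
open Summit.QuantumFields.BalabanUV.T4Continuum.NestedContourTransport (theta0)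
open Summit.QuantumFields.BalabanUV.T4Continuum.RegularSiteTransporters (siteT)
open Summit.QuantumFields.BalabanUV.T4Continuum.NE2BalabanLayer
open Summit.QuantumFields.BalabanUV.T4Continuum.NE2BalabanRoot
open Summit.QuantumFields.BalabanUV.T4Continuum.NE2BalabanGauge (gaugeSlot liftR)
open Summit.QuantumFields.BalabanUV.T4Continuum.NE2BalabanLayerSharp
open Summit.QuantumFields.BalabanUV.T4Continuum.NE2BalabanWiring
open Summit.QuantumFields.BalabanUV.T4Continuum.NE2BalabanFinal (tauR kappa4F C4F perturbationLaws_balaban_final)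
open Summit.QuantumFields.BalabanUV.T4Continuum.GradedWellData
open Summit.QuantumFields.BalabanUV.T4Continuum.GradedWellGram (sigGW)
open Summit.QuantumFields.BalabanUV.T4Continuum.GradedWellConsistencyTransfer (C1Tc C2GW)
open Summit.QuantumFields.BalabanUV.T4Continuum.GradedWellSandwichLaw (CSGW)
open Summit.QuantumFields.BalabanUV.T4Continuum.GradedWellDifference (eGW)
open Summit.QuantumFields.BalabanUV.T4Continuum.GradedWellTowerCoercive (gamGWv)
open Summit.QuantumFields.BalabanUV.T4Continuum.GradedWellMassCommutator (CMGW)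
open Summit.QuantumFields.BalabanUV.T4Continuum.GradedWellColumnsTwoLevel (CbGW)
open Summit.QuantumFields.BalabanUV.T4Continuum.GradedWellTowerEnd (freeTowerLaws_GW)
open Summit.QuantumFields.BalabanUV.T4Continuum.GradedWellBackground (epsGW perturbationLaws_GW_of_tierB)
open Summit.QuantumFields.BalabanUV.T4Continuum.OutputRateTowerSocket (TowerLaw)
open Summit.QuantumFields.BalabanUV.T4Continuum.OutputRateTowerInstance (pertTower towerLaw_perturbed)

variable {d : ℕ} (L : ℕ) [NeZero L] (M : Fin d → ℕ) [hM : ∀ μ, NeZero (M μ)] (m : ℕ) (layer : Tor M → ℕ) (a a' : ℝ)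
  (o : Type*) [Fintype o] [DecidableEq o]

/-- **ROW NE5's W1 LAW FOR THE BACKGROUND-PERTURBED GRADED-WELL TOWERS, from row NE2's `TierBLaws` per family member** (`0 < a`, `1 ≤ d`, `2 ≤ L`,
`layer ≤ m`, `0 < a′`, `‖t‖·κ(1 + ε_GW) < 1`): ONE constant and ONE rate `L⁻¹` for the whole family. [folklore] -/
theorem towerLaw_GW_of_tierB (ha : 0 < a) (hd : 1 ≤ d) (hL : 2 ≤ L) (hlay : ∀ y, layer y ≤ m) (ha' : 0 < a')
    {Jx : Type*} {P : Jx → (k : ℕ) → Matrix (idx L M k × o) (idx L M k × o) ℂ} {κ C₂ : ℝ} (hP : ∀ j, TierBLaws L M a ha (P j) κ C₂)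
    {t : ℂ} (ht : ‖t‖ * (κ * (1 + epsGW d L m a a')) < 1) :
    TowerLaw (fun _ : Jx => fun k => Qlev L M (m + k) ⊗ₖ (1 : Matrix o o ℂ))
      (pertTower (ι := fun k => idx L M (m + k) × o) (fun k => regionGW L M (m + k) m layer a a' ⊗ₖ (1 : Matrix o o ℂ))
        (fun j k => P j (m + k)) t) ((L : ℝ) ^ d)
      (Cpert (κ * (1 + epsGW d L m a a'))
        ((1 + (gamGWv d L m a a')⁻¹ * eGW d L m a a') * (2 * d * Cst d a) * ((L : ℝ)⁻¹) ^ m)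
        (C1Tc d a (gamGWv d L m a a') (eGW d L m a a')
          (C2GW d L a (Cst d a ^ 2 * CMGW L m) (Cst d a ^ 2 * CSGW d L m a' (CbGW d L m a'))) * ((L : ℝ)⁻¹) ^ m)
        ((1 + epsGW d L m a a') ^ 2 * (C₂ * ((L : ℝ)⁻¹) ^ m)) 0 t)
      ((L : ℝ)⁻¹) := by
  have hr : (0 : ℝ) < (L : ℝ) ^ d := pow_pos (by exact_mod_cast Nat.pos_of_ne_zero (NeZero.ne L)) d
  exact towerLaw_perturbed hr (freeTowerLaws_kron o (freeTowerLaws_GW L M m layer a a' ha hd hL hlay ha'))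
    (fun j => perturbationLaws_GW_of_tierB L M m layer a a' o ha hL hlay ha' (hP j))
    (fun k => le_of_eq (by rw [pow_add]; ring)) (fun k => le_of_eq (by rw [pow_add]; ring))
    (fun _ k => le_of_eq (by rw [pow_add]; ring)) (fun _ => by simp) ht

/-- **ROW NE5's W1 LAW FOR THE FAMILY OF BAŁABAN's TYPED TIER-B OPERATORS OVER THE GRADED WELL** (`d ≥ 1`): site-based transporter towers `Rg j`
(DATA) in row B5's (3.35)-shape class with common sizes `α, β`, node NE3's `LocalRate … C L⁻¹` BY NAME for every member (OPEN), the gauge-term parameter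
`b′ > 0`, ROOT B's common smallness `hκ`/`hsmall`, and `‖t‖·κ_B(1 + ε_GW) < 1` — `hP j := NE2BalabanFinal.perturbationLaws_balaban_final` BY NAME.
The graded-well twin of `OutputRateTowerBalaban.towerLaw_balaban_final_of_small`; NE5 / NE2 / NE3 NOT proved. [folklore] -/
theorem towerLaw_GW_balaban (ha : 0 < a) (hd : 1 ≤ d) (hL : 2 ≤ L) (hlay : ∀ y, layer y ≤ m) (ha' : 0 < a')
    {Jx : Type*} {Rg : Jx → (k : ℕ) → Fin d → (Tor (fine (lev L k) M) → Matrix o o ℂ)} {α β : ℝ}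
    (hreg : ∀ j, RegularTransporters L M (liftR L M (Rg j)) α β) {C : ℝ} (hC : 0 ≤ C)
    (hNE3 : ∀ j, LocalRate (bgReadings L M (regClass L M (liftR L M (Rg j)))) C ((L : ℝ)⁻¹)) {b' : ℝ} (hb' : 0 < b')
    (hκ : kappaS d b' α β (tauR d α) < 1)
    (hsmall : ((sigma0 d b') ^ 2)⁻¹ * deltaK (gS d b' (kappaS d b' α β (tauR d α))) (1 + tauR d α) (d * α) (tauR d α) b' < 1)
    {t : ℂ} (ht : ‖t‖ * (kappaBs o d a α β (kappaQ d a (a : ℂ) (epsR o d α)) (kappa4F d a b' α β) * (1 + epsGW d L m a a')) < 1) :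
    TowerLaw (fun _ : Jx => fun k => Qlev L M (m + k) ⊗ₖ (1 : Matrix o o ℂ))
      (pertTower (ι := fun k => idx L M (m + k) × o) (fun k => regionGW L M (m + k) m layer a a' ⊗ₖ (1 : Matrix o o ℂ))
        (fun j k => balabanPert L M a (liftR L M (Rg j)) (gaugeSlot L M (Rg j) (QuT L M o (siteT L M (Rg j))) (Q1 L M o) b') (m + k)) t)
      ((L : ℝ) ^ d)
      (Cpert (kappaBs o d a α β (kappaQ d a (a : ℂ) (epsR o d α)) (kappa4F d a b' α β) * (1 + epsGW d L m a a'))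
        ((1 + (gamGWv d L m a a')⁻¹ * eGW d L m a a') * (2 * d * Cst d a) * ((L : ℝ)⁻¹) ^ m)
        (C1Tc d a (gamGWv d L m a a') (eGW d L m a a')
          (C2GW d L a (Cst d a ^ 2 * CMGW L m) (Cst d a ^ 2 * CSGW d L m a' (CbGW d L m a'))) * ((L : ℝ)⁻¹) ^ m)
        ((1 + epsGW d L m a a') ^ 2 * (C2Bs o d L a α β C
          (a * C2gram (Cst d a) 1 (epsR o d α) (2 * d * Cst d a) (CJ d a) (Cst d a) (CdeltaR o d a α (theta0 d α (betaNE3 o C))))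
          (C4F o d L a b' α β C) * ((L : ℝ)⁻¹) ^ m)) 0 t)
      ((L : ℝ)⁻¹) :=
  towerLaw_GW_of_tierB L M m layer a a' o ha hd hL hlay ha'
    (fun j => perturbationLaws_balaban_final L M a ha hd (hreg j) hC (hNE3 j) hb' hκ hsmall) ht

end Summit.QuantumFields.BalabanUV.T4Continuum.OutputRateTowerGradedWell

end
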